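import Mathlib
import Literature.Combinatorics.Additive.TripleProductProperty
import Summits.MatrixMultiplication.MatrixMultiplication.Theorems.HyperoctahedralThreshold.Negative.SubgroupPivotSieve

/-!
# `ThresholdSubsetTriples` (crux stmt-MatrixMultiplication-10882): no witness family concedes a whole subgroup;
# line `Sketch`'s orbit-kissing transfer is false

Negative-side helper file of line lead c2 (2026-08-17), `sorry`-free, standard axioms.

* `not_thresholdSubgroupMemberTriples` — the crux `X = ThresholdSubsetTriples` (`∀ c > 0`, cofinally in `n`, a TPP
  triple `S, T, U ⊆ S_n` with `(n!)^{3/2}e^{-c√n} < |S||T||U|`) restricted to triples whose FIRST SET IS A SUBGROUP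
  (`S = H` as a finset, `T, U` arbitrary subsets) is FALSE: the subgroup-pivot sieve
  (`HyperoctahedralThreshold.Negative.conceded_subgroup_cap`, p86923: `|H||T||U| ≤ (n!)^{3/2}e^{-(c₂/2)√n}` for
  `n ≥ n₀`, `c₂ = vkUpperConst = (π-2)/π²`, from `|H||T||U| ≤ |G|·d_max(G)` and Vershik–Kerov) contradicts the
  threshold at `c := c₂/4`.  By the rotation symmetry of the TPP the same holds for a subgroup in any of the three
  slots; together with `Negative.not_thresholdYoungTriples` (Young triples) and `stub_cosetCap` (p117691, conceded
  cosets) this is the standing "no conceded subgroup" rule for every line of this crux.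
* `centralizer_transversal_tpp` — ideator 3's orbit-kissing criterion (crux sketch
  `Cruxes/ThresholdSubsetTriples/SketchIdeator3.lean`, reproduced with its proof so that the refutation below is
  self-contained): host `C(μ)` WHOLE, `T ⊆ L`, `U ⊆ L'` with injective footprints `t ↦ t⁻¹μt`, and the `L`- and
  `L'`-conjugation orbits of `μ` kissing only at `μ` ⇒ `(C(μ), T, U)` has the TPP.
* `not_orbitKissingDesign` — **line `Sketch` (transfer 1) is dead**: the transfer statement `OrbitKissingDesign` of
  `SketchIdeator3.lean` (reproduced VERBATIM as the negated proposition; no new `def`) is false, because its first set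
  is the whole subgroup `C(μ)`.  (Its transfer 2, `CovariantTwistDesign`, is `C⁺ = TrialityThreshold`, the crux on
  ℤ/3-symmetric witnesses — not addressed here.)

References: Cohn–Umans 2003 §1.3 (Wedderburn set-up); Blasiak–Church–Cohn–Grochow–Umans 2017 (arXiv:1712.02302) §4;
Vershik–Kerov 1985 (tree `VershikKerov1985_maxCharDegree_holds`).
-/

set_option linter.dupNamespace false

namespace Summit.MatrixMultiplication.MatrixMultiplication.Theorems.ThresholdSubsetTriples.Negative

open Literature.Combinatorics.Additive
open Literature.RepresentationTheory.FiniteGroups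
open Summit.MatrixMultiplication.MatrixMultiplication.Theorems.HyperoctahedralThreshold.Negative
  (conceded_subgroup_cap)

/-- **No threshold family concedes a whole subgroup.**  `X` restricted to triples `(S, T, U)` in which `S` is (the
finset of) a subgroup `H ≤ S_n` is false: at `c := vkUpperConst/4` and `n ≥ n₀` (the threshold of
`conceded_subgroup_cap`) a witness would satisfy
`(n!)^{3/2}e^{-(c₂/4)√n} < |S||T||U| ≤ (n!)^{3/2}e^{-(c₂/2)√n}`, impossible. -/
theorem not_thresholdSubgroupMemberTriples :
    ¬ (∀ c : ℝ, 0 < c → ∀ n₀ : ℕ, ∃ n ≥ n₀, ∃ H : Subgroup (Equiv.Perm (Fin n)),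
        ∃ S T U : Finset (Equiv.Perm (Fin n)), (∀ x, x ∈ S ↔ x ∈ H) ∧ TripleProductProperty S T U ∧
          (n.factorial : ℝ) ^ ((3 : ℝ) / 2) * Real.exp (-(c * Real.sqrt (n : ℝ))) <
            ((S.card * T.card * U.card : ℕ) : ℝ)) := by
  intro h
  obtain ⟨n₁, hcap⟩ := conceded_subgroup_cap
  have hc2 : 0 < vkUpperConst := vkUpperConst_pos
  obtain ⟨n, hn, H, S, T, U, hS, hT, hbig⟩ := h (vkUpperConst / 4) (by linarith) n₁
  have hcapn := hcap n hn H S T U hS hT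
  have hexp : Real.exp (-(vkUpperConst / 2 * Real.sqrt (n : ℝ))) ≤
      Real.exp (-(vkUpperConst / 4 * Real.sqrt (n : ℝ))) := by
    apply Real.exp_le_exp.2
    have hsq : 0 ≤ Real.sqrt (n : ℝ) := Real.sqrt_nonneg _
    nlinarith
  have hF : (0 : ℝ) ≤ (n.factorial : ℝ) ^ ((3 : ℝ) / 2) := by positivity
  have hle := mul_le_mul_of_nonneg_left hexp hF
  linarith

/-- **Orbit-kissing transversals** (ideator 3, `SketchIdeator3.centralizer_transversal_tpp`, reproduced with its
proof).  Host = the centraliser of `μ`, taken WHOLE; `T ⊆ L`, `U ⊆ L'` with injective footprints `t ↦ t⁻¹ μ t`; the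
only hypothesis linking `L` and `L'` is that the conjugation orbits of `μ` under `L` and `L'` meet only in `μ`.  Then
`(C(μ), T, U)` has the TPP. -/
theorem centralizer_transversal_tpp {G : Type*} [Group G] [Fintype G] [DecidableEq G] (μ : G)
    (L L' : Subgroup G)
    (hkiss : ∀ l ∈ L, ∀ l' ∈ L', l * μ * l⁻¹ = l' * μ * l'⁻¹ → l * μ * l⁻¹ = μ)
    (T U : Finset G) (hT : ∀ t ∈ T, t ∈ L) (hU : ∀ u ∈ U, u ∈ L')
    (hTi : ∀ t ∈ T, ∀ t' ∈ T, t⁻¹ * μ * t = t'⁻¹ * μ * t' → t = t')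
    (hUi : ∀ u ∈ U, ∀ u' ∈ U, u⁻¹ * μ * u = u'⁻¹ * μ * u' → u = u') :
    TripleProductProperty (Finset.univ.filter (fun s : G => s * μ = μ * s)) T U := by
  intro s hs s' hs' t ht t' ht' u hu u' hu' hprod
  have hsc : s * μ = μ * s := by simpa using hs
  have hs'c : s' * μ = μ * s' := by simpa using hs'
  -- y := s s'⁻¹ commutes with μ, and (t t'⁻¹)(u u'⁻¹) = y⁻¹
  set y : G := s * s'⁻¹ with hy
  have hyc : y * μ = μ * y := by
    have h1 : s'⁻¹ * μ = μ * s'⁻¹ := by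
      calc s'⁻¹ * μ = s'⁻¹ * (μ * s') * s'⁻¹ := by group
        _ = s'⁻¹ * (s' * μ) * s'⁻¹ := by rw [hs'c]
        _ = μ * s'⁻¹ := by group
    calc y * μ = s * (s'⁻¹ * μ) := by rw [hy]; group
      _ = s * (μ * s'⁻¹) := by rw [h1]
      _ = (s * μ) * s'⁻¹ := by group
      _ = (μ * s) * s'⁻¹ := by rw [hsc]
      _ = μ * y := by rw [hy]; group
  have hrel : t * t'⁻¹ * (u * u'⁻¹) = y⁻¹ := by
    rw [eq_inv_iff_mul_eq_one]
    calc t * t'⁻¹ * (u * u'⁻¹) * y = y⁻¹ * (y * (t * t'⁻¹) * (u * u'⁻¹)) * y := by group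
      _ = 1 := by rw [hy, hprod]; group
  -- l := t' t⁻¹ ∈ L and l' := u u'⁻¹ ∈ L' conjugate μ to the same element
  have hl : t' * t⁻¹ ∈ L := L.mul_mem (hT t' ht') (L.inv_mem (hT t ht))
  have hl' : u * u'⁻¹ ∈ L' := L'.mul_mem (hU u hu) (L'.inv_mem (hU u' hu'))
  have huy : u * u'⁻¹ = (t' * t⁻¹) * y⁻¹ := by
    calc u * u'⁻¹ = (t' * t⁻¹) * (t * t'⁻¹ * (u * u'⁻¹)) := by group
      _ = (t' * t⁻¹) * y⁻¹ := by rw [hrel]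
  have hyinv : y⁻¹ * μ = μ * y⁻¹ := by
    calc y⁻¹ * μ = y⁻¹ * (μ * y) * y⁻¹ := by group
      _ = y⁻¹ * (y * μ) * y⁻¹ := by rw [hyc]
      _ = μ * y⁻¹ := by group
  have hsame : (t' * t⁻¹) * μ * (t' * t⁻¹)⁻¹ = (u * u'⁻¹) * μ * (u * u'⁻¹)⁻¹ := by
    rw [huy]
    calc (t' * t⁻¹) * μ * (t' * t⁻¹)⁻¹
        = (t' * t⁻¹) * (μ * y⁻¹) * y * (t' * t⁻¹)⁻¹ := by group
      _ = (t' * t⁻¹) * (y⁻¹ * μ) * y * (t' * t⁻¹)⁻¹ := by rw [hyinv]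
      _ = t' * t⁻¹ * y⁻¹ * μ * (t' * t⁻¹ * y⁻¹)⁻¹ := by group
  have hfix : (t' * t⁻¹) * μ * (t' * t⁻¹)⁻¹ = μ := hkiss _ hl _ hl' hsame
  -- hence equal footprints, t = t'
  have htt : t = t' := by
    refine hTi t ht t' ht' ?_
    calc t⁻¹ * μ * t = t'⁻¹ * ((t' * t⁻¹) * μ * (t' * t⁻¹)⁻¹) * t' := by group
      _ = t'⁻¹ * μ * t' := by rw [hfix]
  subst htt
  -- then u u'⁻¹ = y⁻¹ commutes with μ, so equal footprints, u = u'
  have huu : u = u' := by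
    refine hUi u hu u' hu' ?_
    have hc : (u * u'⁻¹) * μ = μ * (u * u'⁻¹) := by
      rw [huy]; simp [hyinv]
    calc u⁻¹ * μ * u = u⁻¹ * (μ * (u * u'⁻¹)) * u' := by group
      _ = u⁻¹ * ((u * u'⁻¹) * μ) * u' := by rw [hc]
      _ = u'⁻¹ * μ * u' := by group
  subst huu
  refine ⟨?_, rfl, rfl⟩
  have h1 : s * s'⁻¹ = 1 := by simpa using hprod
  exact mul_inv_eq_one.mp h1

/-- **Line `Sketch`, transfer 1, is dead: `¬ OrbitKissingDesign`.**  The transfer statement of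
`Cruxes/ThresholdSubsetTriples/SketchIdeator3.lean` (reproduced verbatim as the negated proposition) asks, for every
`c > 0` and cofinally in `n`, for a fixed-point-free involution `μ`, subgroups `L, L'` whose `μ`-orbits kiss, and
footprint-injective `T ⊆ L`, `U ⊆ L'` with `(n!)^{3/2}e^{-c√n} < |C(μ)|·|T|·|U|`.  By `centralizer_transversal_tpp`
such a configuration is a TPP triple whose first set is the whole subgroup `C(μ) = Subgroup.centralizer {μ}`, so
`not_thresholdSubgroupMemberTriples` refutes it. -/
theorem not_orbitKissingDesign :
    ¬ (∀ c : ℝ, 0 < c → ∀ n₀ : ℕ, ∃ n ≥ n₀, ∃ μ : Equiv.Perm (Fin n),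
        μ * μ = 1 ∧ (∀ x, μ x ≠ x) ∧
        ∃ L L' : Subgroup (Equiv.Perm (Fin n)),
          (∀ l ∈ L, ∀ l' ∈ L', l * μ * l⁻¹ = l' * μ * l'⁻¹ → l * μ * l⁻¹ = μ) ∧
          ∃ T U : Finset (Equiv.Perm (Fin n)),
            (∀ t ∈ T, t ∈ L) ∧ (∀ u ∈ U, u ∈ L') ∧
            (∀ t ∈ T, ∀ t' ∈ T, t⁻¹ * μ * t = t'⁻¹ * μ * t' → t = t') ∧
            (∀ u ∈ U, ∀ u' ∈ U, u⁻¹ * μ * u = u'⁻¹ * μ * u' → u = u') ∧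
            (n.factorial : ℝ) ^ ((3 : ℝ) / 2) * Real.exp (-(c * Real.sqrt (n : ℝ))) <
              (((Finset.univ.filter (fun s : Equiv.Perm (Fin n) => s * μ = μ * s)).card *
                  T.card * U.card : ℕ) : ℝ)) := by
  intro h
  apply not_thresholdSubgroupMemberTriples
  intro c hc n₀
  obtain ⟨n, hn, μ, -, -, L, L', hkiss, T, U, hT, hU, hTi, hUi, hbig⟩ := h c hc n₀
  refine ⟨n, hn, Subgroup.centralizer {μ}, Finset.univ.filter (fun s : Equiv.Perm (Fin n) => s * μ = μ * s),
    T, U, fun x => ?_, centralizer_transversal_tpp μ L L' hkiss T U hT hU hTi hUi, hbig⟩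
  rw [Finset.mem_filter, Subgroup.mem_centralizer_singleton_iff]
  simp

end Summit.MatrixMultiplication.MatrixMultiplication.Theorems.ThresholdSubsetTriples.Negative
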